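import Summits.QuantumAdvantage.QuantumAdvantage.Theorems.NearExactIsExact.Negative.BqqNineTen
import Summits.QuantumAdvantage.QuantumAdvantage.Theorems.NearExactIsExact.Negative.IsolatingFlat
import Summits.QuantumAdvantage.QuantumAdvantage.Theorems.NearExactIsExact.Negative.MmFormDichotomy

/-!
# `NearExactIsExact` (stmt-QuantumAdvantage-14043) — negative side: **BQQ for frame-preserving biquadratic maps with a
  4-bit nonlinear block, in EVERY dimension** (THEOREM BQQ^tri₄ of DISPROOF §45.10)

Companion of `TriangularBqq` (3-bit block).  Setting: `π, τ` mutually inverse coordinatewise-quadratic maps of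
`𝔽₂^{k+4}` that PRESERVE the first `k` coordinates (frame `t`; nonlinear block `y ∈ 𝔽₂⁴`), `c₁, c₂` cubic, residual
`R = c₁ ⊕ c₂∘π` with slices `R_t` on `𝔽₂⁴`.
* `window_of_bqq4`: restriction / window transfer for any chart `φ : 𝔽₂^j → 𝔽₂^k` with affine coordinates (block 4);
  the kernel-checked windows used: `window_three` (`bqq_seven` on `𝔽₂^{3+4}`: `Σ_{s∈𝔽₂³} wt R_{φ s} = 0` or `≥ 8`),
  `window_five` (`bqq_nine`: `= 0` or `≥ 16`), `window_six4` (`bqq_ten`: `= 0` or `≥ 32`).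
* `slice_even`: every slice `R_t` has even weight (a cubic on 4 bits is even; `π_t` is a bijection).
* `bqq_triangular_four`: `R ≡ 0` or `4·wt(R) ≥ 2^{k+1}` (i.e. `wt(R) ≥ 2^{m-5}`, `m = k + 4`): least defective slice
  weight `< 8` ⇒ isolating 3-flats force `|N|·8 ≥ 2^{k+1}` and `wt ≥ 2|N|`; in `[8,16)` ⇒ 5-flats, `|N|·32 ≥ 2^{k+1}`,
  `wt ≥ 8|N|`; all full ⇒ 6-flats, `|N|·64 ≥ 2^{k+1}`, `wt = 16|N|` (`N` = defective slices,
  `IsolatingFlat.exists_affine_isolating`).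
* `mmForm_gap_triangular_four`: MM sign-form pairs over such `π` (cubic dual word) have `Φ = 1 ∨ Φ ≤ 15/16` at every
  `n = 2(k+4)`.
So frame-preserving biquadratic maps with a nonlinear block of `≤ 4` bits never beat `15/16` in MM form (this corrects
the provisional "31/32 sliver" of DISPROOF §45.9).  HONEST FRAMING: a structural theorem on the NEGATIVE side of the
crux; no Theses statement is asserted; standard axioms; NOT summit progress.
-/

set_option linter.dupNamespace false -- D-0017: single-problem summit ⇒ `QuantumAdvantage.QuantumAdvantage` by design

namespace Summit.QuantumAdvantage.QuantumAdvantage.Theorems.NearExactIsExact.Negative.TriangularBqqFour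

open Finset
open Literature.Computability.QuantumComplexity
open Literature.Computability.QuantumComplexity.BuzetChailloux (zeroVec)
open Summit.QuantumAdvantage.QuantumAdvantage.Theorems.CubicForrelation.NearExactIsExact
  (fc_isDegLeFun_comp fc_sum_signOf_eq_card acx_deg_coord_append_right)
open Summit.QuantumAdvantage.QuantumAdvantage.Theorems.NearExactIsExact.Negative.ProjectionConcat (card_filter_append)
open Summit.QuantumAdvantage.QuantumAdvantage.Theorems.NearExactIsExact.Negative.ProductTest (even_card_of_deg_lt)
open Summit.QuantumAdvantage.QuantumAdvantage.Theorems.NearExactIsExact.Negative.BqqSeven (bqq_seven bq_card_filter_comp)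
open Summit.QuantumAdvantage.QuantumAdvantage.Theorems.NearExactIsExact.Negative.BqqNineTen (bqq_nine bqq_ten)
open Summit.QuantumAdvantage.QuantumAdvantage.Theorems.NearExactIsExact.Negative.IsolatingFlat
  (exists_affine_isolating card_xor_add)
open Summit.QuantumAdvantage.QuantumAdvantage.Theorems.NearExactIsExact.Negative.MmFormDichotomy (mmForm_dichotomy)

variable {k : ℕ}

/-- **Restriction / window transfer.** Let `π, τ` be mutually inverse coordinatewise-quadratic maps of `𝔽₂^{k+4}`
with `π` preserving the first `k` coordinates, `c₁, c₂` cubic, and `φ : 𝔽₂^j → 𝔽₂^k` a map with affine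
coordinates. If every biquadratic configuration on `j + 4` bits has residual weight `0` or `≥ W` (a BQQ window), then
`Σ_s #{y : c₁(φ s ‖ y) ≠ c₂(π(φ s ‖ y))}` is `0` (all these slices vanish) or `≥ W`. -/
theorem window_of_bqq4 (j W : ℕ)
    (hbqq : ∀ (π' τ' : (Fin (j + 4) → Bool) → (Fin (j + 4) → Bool)),
      (∀ i, IsDegLeFun 2 (fun y => π' y i)) → (∀ i, IsDegLeFun 2 (fun x => τ' x i)) → (∀ y, τ' (π' y) = y) →
      ∀ (c₁ c₂ : (Fin (j + 4) → Bool) → Bool), IsDegLeFun 3 c₁ → IsDegLeFun 3 c₂ →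
        (∀ y, c₁ y = c₂ (π' y)) ∨ W ≤ #(univ.filter fun y => (c₁ y ^^ c₂ (π' y)) = true))
    (π τ : (Fin (k + 4) → Bool) → (Fin (k + 4) → Bool))
    (hπ : ∀ i, IsDegLeFun 2 (fun z => π z i)) (hτ : ∀ i, IsDegLeFun 2 (fun z => τ z i))
    (hτπ : ∀ z, τ (π z) = z) (hpres : ∀ z (i : Fin k), π z (Fin.castAdd 4 i) = z (Fin.castAdd 4 i))
    (c₁ c₂ : (Fin (k + 4) → Bool) → Bool) (h₁ : IsDegLeFun 3 c₁) (h₂ : IsDegLeFun 3 c₂)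
    (φ : (Fin j → Bool) → (Fin k → Bool)) (hφ : ∀ x, IsDegLeFun 1 (fun s => φ s x)) :
    (∀ s y, c₁ (Fin.append (φ s) y) = c₂ (π (Fin.append (φ s) y))) ∨
      W ≤ ∑ s : Fin j → Bool,
        #(univ.filter fun y : Fin 4 → Bool => (c₁ (Fin.append (φ s) y) ^^ c₂ (π (Fin.append (φ s) y))) = true) := by
  classical
  -- the chart `Ψ(s ‖ y) = (φ s ‖ y)` and the pulled-back maps
  set Ψ : (Fin (j + 4) → Bool) → (Fin (k + 4) → Bool) :=
    fun z => Fin.append (φ (fun i => z (Fin.castAdd 4 i))) (fun i => z (Fin.natAdd j i)) with hΨ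
  set π' : (Fin (j + 4) → Bool) → (Fin (j + 4) → Bool) :=
    fun z => Fin.append (fun i => z (Fin.castAdd 4 i)) (fun i => π (Ψ z) (Fin.natAdd k i)) with hπ'
  set τ' : (Fin (j + 4) → Bool) → (Fin (j + 4) → Bool) :=
    fun z => Fin.append (fun i => z (Fin.castAdd 4 i)) (fun i => τ (Ψ z) (Fin.natAdd k i)) with hτ'
  have hΨdeg : ∀ v, IsDegLeFun 1 (fun z => Ψ z v) := by
    intro v
    induction v using Fin.addCases with
    | left x =>
      simp only [hΨ, Fin.append_left]
      exact fc_isDegLeFun_comp (hφ x) (fun (z : Fin (j + 4) → Bool) (i : Fin j) => z (Fin.castAdd 4 i))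
        (fun i => isDegLeFun_apply (Fin.castAdd 4 i) le_rfl) le_rfl
    | right i =>
      simp only [hΨ, Fin.append_right]
      exact isDegLeFun_apply (Fin.natAdd j i) le_rfl
  have hdeg' : ∀ (σ : (Fin (k + 4) → Bool) → (Fin (k + 4) → Bool)), (∀ i, IsDegLeFun 2 (fun z => σ z i)) →
      ∀ v, IsDegLeFun 2 (fun z : Fin (j + 4) → Bool =>
        Fin.append (fun i => z (Fin.castAdd 4 i)) (fun i => σ (Ψ z) (Fin.natAdd k i)) v) := by
    intro σ hσ v
    induction v using Fin.addCases with
    | left x =>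
      simp only [Fin.append_left]
      exact isDegLeFun_apply (Fin.castAdd 4 x) (by norm_num)
    | right i =>
      simp only [Fin.append_right]
      exact fc_isDegLeFun_comp (hσ (Fin.natAdd k i)) Ψ hΨdeg le_rfl
  have hπ'deg : ∀ v, IsDegLeFun 2 (fun z => π' z v) := hdeg' π hπ
  have hτ'deg : ∀ v, IsDegLeFun 2 (fun z => τ' z v) := hdeg' τ hτ
  -- semi-conjugacy `Ψ ∘ π' = π ∘ Ψ` (uses that `π` preserves the frame coordinates)
  have hsemi : ∀ z, Ψ (π' z) = π (Ψ z) := by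
    intro z
    funext v
    induction v using Fin.addCases with
    | left x =>
      rw [hpres]
      simp only [hΨ, hπ', Fin.append_left]
    | right i =>
      simp only [hΨ, hπ', Fin.append_right]
  have hinv : ∀ z, τ' (π' z) = z := by
    intro z
    funext v
    induction v using Fin.addCases with
    | left x => simp only [hτ', hπ', Fin.append_left]
    | right i =>
      have e : τ' (π' z) (Fin.natAdd j i) = τ (Ψ (π' z)) (Fin.natAdd k i) := by
        simp only [hτ', Fin.append_right]
      rw [e, hsemi, hτπ]
      simp only [hΨ, Fin.append_right]
  have hc : ∀ c : (Fin (k + 4) → Bool) → Bool, IsDegLeFun 3 c → IsDegLeFun 3 (fun z => c (Ψ z)) :=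
    fun c hcd => fc_isDegLeFun_comp hcd Ψ hΨdeg le_rfl
  have hΨapp : ∀ (s : Fin j → Bool) (y : Fin 4 → Bool), Ψ (Fin.append s y) = Fin.append (φ s) y := by
    intro s y
    simp only [hΨ, Fin.append_left, Fin.append_right]
  rcases hbqq π' τ' hπ'deg hτ'deg hinv (fun z => c₁ (Ψ z)) (fun z => c₂ (Ψ z)) (hc c₁ h₁) (hc c₂ h₂) with
    hall | hW
  · left
    intro s y
    have e : c₁ (Ψ (Fin.append s y)) = c₂ (Ψ (π' (Fin.append s y))) := hall (Fin.append s y)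
    rw [hsemi, hΨapp] at e
    exact e
  · right
    have e : #(univ.filter fun z : Fin (j + 4) → Bool => (c₁ (Ψ z) ^^ c₂ (Ψ (π' z))) = true) =
        ∑ s : Fin j → Bool, #(univ.filter fun y : Fin 4 → Bool =>
          (c₁ (Fin.append (φ s) y) ^^ c₂ (π (Fin.append (φ s) y))) = true) := by
      rw [card_filter_append]
      refine sum_congr rfl fun s _ => ?_
      congr 1
      ext y
      simp only [mem_filter, mem_univ, true_and]
      rw [hsemi, hΨapp]
    simpa only [e] using hW

/-- **Window on 3-flats** (`bqq_seven` on `𝔽₂^{3+4}`): `Σ_{s ∈ 𝔽₂³} wt(R_{φ s}) = 0` or `≥ 8`. -/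
theorem window_three (π τ : (Fin (k + 4) → Bool) → (Fin (k + 4) → Bool))
    (hπ : ∀ i, IsDegLeFun 2 (fun z => π z i)) (hτ : ∀ i, IsDegLeFun 2 (fun z => τ z i))
    (hτπ : ∀ z, τ (π z) = z) (hpres : ∀ z (i : Fin k), π z (Fin.castAdd 4 i) = z (Fin.castAdd 4 i))
    (c₁ c₂ : (Fin (k + 4) → Bool) → Bool) (h₁ : IsDegLeFun 3 c₁) (h₂ : IsDegLeFun 3 c₂)
    (φ : (Fin 3 → Bool) → (Fin k → Bool)) (hφ : ∀ x, IsDegLeFun 1 (fun s => φ s x)) :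
    (∀ s y, c₁ (Fin.append (φ s) y) = c₂ (π (Fin.append (φ s) y))) ∨
      8 ≤ ∑ s : Fin 3 → Bool,
        #(univ.filter fun y : Fin 4 → Bool => (c₁ (Fin.append (φ s) y) ^^ c₂ (π (Fin.append (φ s) y))) = true) :=
  window_of_bqq4 3 8 (fun π' τ' hπ' hτ' hτπ' c₁' c₂' h₁' h₂' => bqq_seven π' τ' hπ' hτ' hτπ' c₁' c₂' h₁' h₂')
    π τ hπ hτ hτπ hpres c₁ c₂ h₁ h₂ φ hφ

/-- **Window on 5-flats** (`bqq_nine` on `𝔽₂^{5+4}`): `Σ_{s ∈ 𝔽₂⁵} wt(R_{φ s}) = 0` or `≥ 16`. -/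
theorem window_five (π τ : (Fin (k + 4) → Bool) → (Fin (k + 4) → Bool))
    (hπ : ∀ i, IsDegLeFun 2 (fun z => π z i)) (hτ : ∀ i, IsDegLeFun 2 (fun z => τ z i))
    (hτπ : ∀ z, τ (π z) = z) (hpres : ∀ z (i : Fin k), π z (Fin.castAdd 4 i) = z (Fin.castAdd 4 i))
    (c₁ c₂ : (Fin (k + 4) → Bool) → Bool) (h₁ : IsDegLeFun 3 c₁) (h₂ : IsDegLeFun 3 c₂)
    (φ : (Fin 5 → Bool) → (Fin k → Bool)) (hφ : ∀ x, IsDegLeFun 1 (fun s => φ s x)) :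
    (∀ s y, c₁ (Fin.append (φ s) y) = c₂ (π (Fin.append (φ s) y))) ∨
      16 ≤ ∑ s : Fin 5 → Bool,
        #(univ.filter fun y : Fin 4 → Bool => (c₁ (Fin.append (φ s) y) ^^ c₂ (π (Fin.append (φ s) y))) = true) :=
  window_of_bqq4 5 16 (fun π' τ' hπ' hτ' hτπ' c₁' c₂' h₁' h₂' => bqq_nine π' τ' hπ' hτ' hτπ' c₁' c₂' h₁' h₂')
    π τ hπ hτ hτπ hpres c₁ c₂ h₁ h₂ φ hφ

/-- **Window on 6-flats** (`bqq_ten` on `𝔽₂^{6+4}`): `Σ_{s ∈ 𝔽₂⁶} wt(R_{φ s}) = 0` or `≥ 32`. -/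
theorem window_six4 (π τ : (Fin (k + 4) → Bool) → (Fin (k + 4) → Bool))
    (hπ : ∀ i, IsDegLeFun 2 (fun z => π z i)) (hτ : ∀ i, IsDegLeFun 2 (fun z => τ z i))
    (hτπ : ∀ z, τ (π z) = z) (hpres : ∀ z (i : Fin k), π z (Fin.castAdd 4 i) = z (Fin.castAdd 4 i))
    (c₁ c₂ : (Fin (k + 4) → Bool) → Bool) (h₁ : IsDegLeFun 3 c₁) (h₂ : IsDegLeFun 3 c₂)
    (φ : (Fin 6 → Bool) → (Fin k → Bool)) (hφ : ∀ x, IsDegLeFun 1 (fun s => φ s x)) :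
    (∀ s y, c₁ (Fin.append (φ s) y) = c₂ (π (Fin.append (φ s) y))) ∨
      32 ≤ ∑ s : Fin 6 → Bool,
        #(univ.filter fun y : Fin 4 → Bool => (c₁ (Fin.append (φ s) y) ^^ c₂ (π (Fin.append (φ s) y))) = true) :=
  window_of_bqq4 6 32 (fun π' τ' hπ' hτ' hτπ' c₁' c₂' h₁' h₂' => bqq_ten π' τ' hπ' hτ' hτπ' c₁' c₂' h₁' h₂')
    π τ hπ hτ hτπ hpres c₁ c₂ h₁ h₂ φ hφ

/-! ### Slice evenness -/

/-- Every residual slice `R_t = (c₁ ⊕ c₂∘π)(t ‖ ·)` on `𝔽₂⁴` has even weight: `|R_t| ≡ |c₁(t‖·)| + |c₂(t‖·)|`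
(`y ↦ π_t y` is a bijection) and a cubic on 4 bits has even weight. -/
theorem slice_even (π τ : (Fin (k + 4) → Bool) → (Fin (k + 4) → Bool))
    (hτπ : ∀ z, τ (π z) = z) (hpres : ∀ z (i : Fin k), π z (Fin.castAdd 4 i) = z (Fin.castAdd 4 i))
    (c₁ c₂ : (Fin (k + 4) → Bool) → Bool) (h₁ : IsDegLeFun 3 c₁) (h₂ : IsDegLeFun 3 c₂) (t : Fin k → Bool) :
    Even #(univ.filter fun y : Fin 4 → Bool => (c₁ (Fin.append t y) ^^ c₂ (π (Fin.append t y))) = true) := by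
  classical
  have hsplit : ∀ y : Fin 4 → Bool,
      π (Fin.append t y) = Fin.append t (fun i => π (Fin.append t y) (Fin.natAdd k i)) := by
    intro y
    funext v
    induction v using Fin.addCases with
    | left x => rw [Fin.append_left, hpres, Fin.append_left]
    | right i => rw [Fin.append_right]
  have hbij : Function.Bijective (fun y : Fin 4 → Bool => fun i => π (Fin.append t y) (Fin.natAdd k i)) := by
    refine Finite.injective_iff_bijective.1 fun y₁ y₂ hy => ?_
    have e : Fin.append t y₁ = Fin.append t y₂ := by
      rw [← hτπ (Fin.append t y₁), ← hτπ (Fin.append t y₂), hsplit y₁, hsplit y₂]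
      exact congrArg τ (congrArg (Fin.append t) hy)
    funext i
    have := congrFun e (Fin.natAdd k i)
    rwa [Fin.append_right, Fin.append_right] at this
  have hQ : #(univ.filter fun y : Fin 4 → Bool => c₂ (π (Fin.append t y)) = true) =
      #(univ.filter fun y : Fin 4 → Bool => c₂ (Fin.append t y) = true) := by
    have e : (univ.filter fun y : Fin 4 → Bool => c₂ (π (Fin.append t y)) = true) =
        univ.filter fun y => (fun y' => c₂ (Fin.append t y'))
          ((fun y : Fin 4 → Bool => fun i => π (Fin.append t y) (Fin.natAdd k i)) y) = true :=
      filter_congr fun y _ => by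
        simp only
        rw [← hsplit y]
    rw [e]
    exact bq_card_filter_comp (fun y : Fin 4 → Bool => fun i => π (Fin.append t y) (Fin.natAdd k i)) hbij
      (fun y' => c₂ (Fin.append t y'))
  -- slices of a cubic are cubic on 4 bits, hence even
  have hsl : ∀ c : (Fin (k + 4) → Bool) → Bool, IsDegLeFun 3 c →
      Even #(univ.filter fun y : Fin 4 → Bool => c (Fin.append t y) = true) := by
    intro c hc
    refine even_card_of_deg_lt (fc_isDegLeFun_comp hc (fun y : Fin 4 → Bool => Fin.append t y)
      (fun v => ?_) (show 1 * 3 ≤ 3 by norm_num)) (by norm_num : 3 < 4)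
    induction v using Fin.addCases with
    | left x =>
      simp only [Fin.append_left]
      exact isDegLeFun_const 1 (t x)
    | right i =>
      simp only [Fin.append_right]
      exact isDegLeFun_apply i le_rfl
  have k1 := card_xor_add (fun y : Fin 4 → Bool => c₁ (Fin.append t y)) (fun y => c₂ (π (Fin.append t y)))
  rw [hQ] at k1
  obtain ⟨a, ha⟩ := hsl c₁ h₁
  obtain ⟨b, hb⟩ := hsl c₂ h₂
  exact ⟨a + b - #(univ.filter fun y : Fin 4 → Bool => (c₁ (Fin.append t y) && c₂ (π (Fin.append t y))) = true),
    by omega⟩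

/-! ### Assembly -/

/-- **THEOREM BQQ^tri₄** (DISPROOF §45.10, all dimensions). Let `π, τ` be mutually inverse coordinatewise-quadratic
maps of `𝔽₂^{k+4}` with `π` preserving the first `k` coordinates, and `c₁, c₂` cubic. Then `R = c₁ ⊕ c₂∘π` is
identically zero or `4·wt(R) ≥ 2^{k+1}`, i.e. `wt(R) ≥ 2^{m-5}` with `m = k + 4`. -/
theorem bqq_triangular_four (π τ : (Fin (k + 4) → Bool) → (Fin (k + 4) → Bool))
    (hπ : ∀ i, IsDegLeFun 2 (fun z => π z i)) (hτ : ∀ i, IsDegLeFun 2 (fun z => τ z i))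
    (hτπ : ∀ z, τ (π z) = z) (hpres : ∀ z (i : Fin k), π z (Fin.castAdd 4 i) = z (Fin.castAdd 4 i))
    (c₁ c₂ : (Fin (k + 4) → Bool) → Bool) (h₁ : IsDegLeFun 3 c₁) (h₂ : IsDegLeFun 3 c₂) :
    (∀ z, c₁ z = c₂ (π z)) ∨
      2 ^ (k + 1) ≤ 4 * #(univ.filter fun z : Fin (k + 4) → Bool => (c₁ z ^^ c₂ (π z)) = true) := by
  classical
  set w : (Fin k → Bool) → ℕ := fun t =>
    #(univ.filter fun y : Fin 4 → Bool => (c₁ (Fin.append t y) ^^ c₂ (π (Fin.append t y))) = true) with hw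
  have htot : #(univ.filter fun z : Fin (k + 4) → Bool => (c₁ z ^^ c₂ (π z)) = true) = ∑ t, w t :=
    card_filter_append (n₁ := k) (n₂ := 4) _
  have hw16 : ∀ t, w t ≤ 16 := fun t =>
    (card_filter_le _ _).trans (by rw [card_univ, Fintype.card_fun, Fintype.card_bool, Fintype.card_fin]; norm_num)
  have hev : ∀ t, Even (w t) := slice_even π τ hτπ hpres c₁ c₂ h₁ h₂
  set N : Finset (Fin k → Bool) := univ.filter fun t => w t ≠ 0 with hN
  have hsumN : ∑ t ∈ N, w t = ∑ t, w t := sum_filter_ne_zero _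
  have hzero : ∀ t, t ∉ N → w t = 0 := fun t ht => by
    by_contra h
    exact ht (mem_filter.2 ⟨mem_univ _, h⟩)
  have key : ∀ (j W : ℕ),
      (∀ (φ : (Fin j → Bool) → (Fin k → Bool)), (∀ x, IsDegLeFun 1 (fun s => φ s x)) →
        (∀ s y, c₁ (Fin.append (φ s) y) = c₂ (π (Fin.append (φ s) y))) ∨
          W ≤ ∑ s : Fin j → Bool, w (φ s)) →
      ∀ t₀, w t₀ ≠ 0 → w t₀ < W → 2 ^ (k + 1) ≤ #N * 2 ^ j := by
    intro j W hwin t₀ h0 hlt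
    by_contra hlt'
    obtain ⟨φ, hφ, hφ0, hφN⟩ := exists_affine_isolating N t₀ j (not_le.1 hlt')
    rcases hwin φ hφ with hall | hW
    · apply h0
      rw [hw]
      refine card_eq_zero.2 (filter_eq_empty_iff.2 fun y _ => ?_)
      show ¬ ((c₁ (Fin.append t₀ y) ^^ c₂ (π (Fin.append t₀ y))) = true)
      have e := hall (fun _ => false) y
      rw [hφ0] at e
      rw [e, Bool.xor_self]
      exact Bool.false_ne_true
    · have hs : ∑ s : Fin j → Bool, w (φ s) = w t₀ := by
        rw [Finset.sum_eq_single_of_mem (fun _ => false) (mem_univ _) fun s _ hs => hzero _ (hφN s hs), hφ0]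
      rw [hs] at hW
      exact absurd hW (not_le.2 hlt)
  by_cases hNe : N = ∅
  · left
    intro z
    have hz : w (fun i => z (Fin.castAdd 4 i)) = 0 := by
      refine hzero _ ?_
      rw [hNe]
      simp
    have hz' := filter_eq_empty_iff.1 (card_eq_zero.1 hz) (mem_univ (fun i => z (Fin.natAdd k i)))
    rw [Fin.append_castAdd_natAdd] at hz'
    revert hz'
    cases c₁ z <;> cases c₂ (π z) <;> simp
  · right
    rw [htot, ← hsumN]
    have hpos : ∀ t ∈ N, 2 ≤ w t := by
      intro t ht
      have h0 : w t ≠ 0 := (mem_filter.1 ht).2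
      obtain ⟨a, ha⟩ := hev t
      omega
    by_cases hA : ∃ t ∈ N, w t < 8
    · -- CASE A: a light defective slice; 3-flat windows
      obtain ⟨t₁, ht₁, hlt⟩ := hA
      have h8 := key 3 8 (fun φ hφ => window_three π τ hπ hτ hτπ hpres c₁ c₂ h₁ h₂ φ hφ) t₁
        (mem_filter.1 ht₁).2 hlt
      have hs : #N * 2 ≤ ∑ t ∈ N, w t := by
        simpa [smul_eq_mul] using Finset.card_nsmul_le_sum N w 2 hpos
      calc 2 ^ (k + 1) ≤ #N * 2 ^ 3 := h8
        _ = 4 * (#N * 2) := by ring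
        _ ≤ 4 * ∑ t ∈ N, w t := Nat.mul_le_mul_left _ hs
    · push Not at hA
      by_cases hB : ∃ t ∈ N, w t < 16
      · -- CASE B: all defective slices weigh ≥ 8, one is not full; 5-flat windows
        obtain ⟨t₁, ht₁, hlt⟩ := hB
        have h32 := key 5 16 (fun φ hφ => window_five π τ hπ hτ hτπ hpres c₁ c₂ h₁ h₂ φ hφ) t₁
          (mem_filter.1 ht₁).2 hlt
        have hs : #N * 8 ≤ ∑ t ∈ N, w t := by
          simpa [smul_eq_mul] using Finset.card_nsmul_le_sum N w 8 hA
        calc 2 ^ (k + 1) ≤ #N * 2 ^ 5 := h32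
          _ = 4 * (#N * 8) := by ring
          _ ≤ 4 * ∑ t ∈ N, w t := Nat.mul_le_mul_left _ hs
      · -- CASE C: all defective slices full; 6-flat windows
        push Not at hB
        obtain ⟨t₀, ht₀⟩ := nonempty_iff_ne_empty.2 hNe
        have h64 := key 6 32 (fun φ hφ => window_six4 π τ hπ hτ hτπ hpres c₁ c₂ h₁ h₂ φ hφ) t₀
          (mem_filter.1 ht₀).2 (lt_of_le_of_lt (hw16 t₀) (by norm_num))
        have hs : #N * 16 ≤ ∑ t ∈ N, w t := by
          simpa [smul_eq_mul] using Finset.card_nsmul_le_sum N w 16 hB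
        calc 2 ^ (k + 1) ≤ #N * 2 ^ 6 := h64
          _ = 4 * (#N * 16) := by ring
          _ ≤ 4 * ∑ t ∈ N, w t := Nat.mul_le_mul_left _ hs

/-- The same bound in the `2^{m-5}` form (`m = k + 4`, `k ≥ 1`). -/
theorem bqq_triangular_four' (hk : 1 ≤ k) (π τ : (Fin (k + 4) → Bool) → (Fin (k + 4) → Bool))
    (hπ : ∀ i, IsDegLeFun 2 (fun z => π z i)) (hτ : ∀ i, IsDegLeFun 2 (fun z => τ z i))
    (hτπ : ∀ z, τ (π z) = z) (hpres : ∀ z (i : Fin k), π z (Fin.castAdd 4 i) = z (Fin.castAdd 4 i))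
    (c₁ c₂ : (Fin (k + 4) → Bool) → Bool) (h₁ : IsDegLeFun 3 c₁) (h₂ : IsDegLeFun 3 c₂) :
    (∀ z, c₁ z = c₂ (π z)) ∨
      2 ^ (k - 1) ≤ #(univ.filter fun z : Fin (k + 4) → Bool => (c₁ z ^^ c₂ (π z)) = true) := by
  rcases bqq_triangular_four π τ hπ hτ hτπ hpres c₁ c₂ h₁ h₂ with h | h
  · exact Or.inl h
  · right
    obtain ⟨d, rfl⟩ := Nat.exists_eq_add_of_le hk
    rw [show 1 + d - 1 = d from by omega]
    have e : 2 ^ (1 + d + 1) = 4 * 2 ^ d := by ring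
    rw [e] at h
    exact Nat.le_of_mul_le_mul_left h (by norm_num)

/-! ### Consequence: one-sided MM gap over frame-preserving maps with a 4-bit block, every `n = 2(k+4)` -/

/-- **One-sided MM gap, 4-bit block, all `n = 2(k+4)`.** Every cubic `f` and every `g` in Maiorana–McFarland sign
form over a coordinatewise-quadratic `π : 𝔽₂^{k+4} → 𝔽₂^{k+4}` preserving the first `k` coordinates, with cubic dual
word `h`, satisfy `Φ(f,g) = 1 ∨ Φ(f,g) ≤ 15/16` (`mmForm_dichotomy` + `bqq_triangular_four`). -/
theorem mmForm_gap_triangular_four (f g : (Fin ((k + 4) + (k + 4)) → Bool) → Bool)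
    (π : (Fin (k + 4) → Bool) → (Fin (k + 4) → Bool)) (h : (Fin (k + 4) → Bool) → Bool)
    (hf : IsDegLeFun 3 f) (hπ : ∀ i, IsDegLeFun 2 (fun y => π y i))
    (hpres : ∀ z (i : Fin k), π z (Fin.castAdd 4 i) = z (Fin.castAdd 4 i)) (hh : IsDegLeFun 3 h)
    (hg : ∀ y₁ y₂ : Fin (k + 4) → Bool, signOf (g (Fin.append y₁ y₂)) = twist y₁ (π y₂) * signOf (h y₂)) :
    forrelation f g = 1 ∨ forrelation f g ≤ 15 / 16 := by
  classical
  rcases mmForm_dichotomy f g π h hf hπ hg with hle | ⟨τ, hτ, hτπ, hΦ⟩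
  · exact Or.inr hle
  have hk : IsDegLeFun 3 (fun a : Fin (k + 4) → Bool => f (Fin.append a zeroVec)) :=
    fc_isDegLeFun_comp hf (fun a : Fin (k + 4) → Bool => Fin.append a zeroVec) (acx_deg_coord_append_right zeroVec)
      (by norm_num)
  have hpos : (0 : ℝ) < 2 ^ (k + 4) := by positivity
  rw [hΦ]
  rcases bqq_triangular_four π τ hπ hτ hτπ hpres h (fun a => f (Fin.append a zeroVec)) hh hk with h0 | hw
  · left
    rw [show ∑ y, signOf (h y ^^ f (Fin.append (π y) zeroVec)) = ∑ _y : Fin (k + 4) → Bool, (1 : ℝ) from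
      sum_congr rfl fun y _ => by rw [h0 y, Bool.xor_self]; rfl, sum_const, card_univ, Fintype.card_fun,
      Fintype.card_bool, Fintype.card_fin, nsmul_eq_mul, mul_one]
    push_cast
    exact inv_mul_cancel₀ hpos.ne'
  · right
    have hw2 : 2 ^ (k + 4) ≤ 32 * #(univ.filter fun y : Fin (k + 4) → Bool =>
        (h y ^^ f (Fin.append (π y) zeroVec)) = true) := by
      have e : 2 ^ (k + 4) = 8 * 2 ^ (k + 1) := by ring
      omega
    have hw' := (Nat.cast_le (α := ℝ)).2 hw2
    push_cast at hw'
    rw [fc_sum_signOf_eq_card, inv_mul_le_iff₀ hpos]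
    linarith

end Summit.QuantumAdvantage.QuantumAdvantage.Theorems.NearExactIsExact.Negative.TriangularBqqFour
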